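import Literature.AlgebraicGeometry.RelativeSpec.DescentOfUnitAlongFreeQuotient
import HarnessLib

/-!
# Two modules on a free finite quotient whose pull-backs are trivial with the SAME character are isomorphic
# ([MumfordAV1970] §12 Thm. 1 / §15 Thm. 1: `ker(Pic(X/G) → Pic X) ↪ Hom(G, Γ(X, 𝒪_X)ˣ)`)

Layer `Literature/AlgebraicGeometry/RelativeSpec`, namespace `Literature.AlgebraicGeometry.RelativeSpec.ActionOver`; sequel of ★
`DescentOfUnitAlongFreeQuotient` (B-p12 (g14)), same generic setting: an action `ρ` of a finite group `G` on `X` over `Q` with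
`p : X ⟶ Q` an affine flat geometric quotient by a FREE action.  THEOREMS ONLY (no definition, no named fact, no instance, no
`sorry`).

For a module `M` on `Q` with a trivialisation `e : p^* 𝒪_Q ≅ p^* M` the generator `s := e(η_p 1)` of `p^* M` is an eigen-section
of the canonical linearisation (★ `EquivariantStructure.ofPullback`): `g · s = a_g · s` with `a_g ∈ Γ(X, 𝒪)` (★
`exists_eq_smul_of_iso_unit`); [MumfordAV1970] §12 Thm. 1 says the isomorphism class of `M` is the class of the cocycle `g ↦ a_g` in
`H¹(G, Γ(X, 𝒪_X)ˣ)`.  ★ `nonempty_iso_unit_of_actSections_eq` is the case `a = 1 ⇒ M ≅ 𝒪_Q`; this file proves the general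
injectivity statement consumed by the dual-isogeny kernel count ([MumfordAV1970] §15 Thm. 1): **two such modules with the SAME
eigenvalues `a_g` are isomorphic** (`nonempty_iso_of_actSections_eq_smul`).  Proof: the composite `p^* M₂ ≅ p^* 𝒪_Q ≅ p^* M₁`
sends pulled-back sections of `M₂` (which are invariant, ★ `actSections_unitSection_ofPullback`, and of the form `b · s₂` with
`σ_g^♯(b) · a_g = b`) to the invariant sections `b · s₁`, so `M₂` compares isomorphically with the invariants `(p_* p^* M₁)^G ≅ M₁`
(★ T1 `isIso_descentHom`, ★ `exists_hom_moduleInvariants_fac_of_actSections`, ★ `isIso_of_isIso_pullback_map`).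

* §1 `exists_eq_smul_unitSection_one` (sections of `p^* 𝒪_Q` over `p⁻¹V` are multiples of `η_p(1_V)`), `eq_of_smul_generator_eq`
  (coefficients on the generator `e(η_p 1_V)` are unique), `actSections_generator_eq_smul_of_top` (the eigen-relation restricts
  from `⊤` to every `V`);
* §2 **`nonempty_iso_of_actSections_eq_smul`**.

Cell `hodgecm-mathlib` (D-0151), HECKE-LINK socket (B), brick (K5c-1) core («descent-character injection», B-p02 (g11); road
(R-dual) at a point, B-p20 (g9) 23:15Z / B-p09 (g10) 23:11Z); count-neutral.  HC_CM is proved only modulo the 7 printed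
citations until rung 0 closes.

## References
* [MumfordAV1970] D. Mumford, *Abelian Varieties* (1970), §7 Prop. 2 (p. 70), §12 Thm. 1 (p. 112), §15 Thm. 1 (p. 143).
* [Greither1992CyclicGalois] C. Greither, LNM 1534 (1992), Ch. 0 Thm. 7.1, Prop. 7.2 (pp. 28–29).
-/

set_option autoImplicit false

noncomputable section

-- `TopCat.Presheaf`/`Scheme.Modules` are not reducible (as in Mathlib's `AlgebraicGeometry/Modules`).
set_option backward.isDefEq.respectTransparency false

universe u

open CategoryTheory Limits AlgebraicGeometry TopologicalSpace Opposite
open Literature.AlgebraicGeometry.Modules Literature.AlgebraicGeometry.HodgeTheory Literature.AlgebraicGeometry.Motives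

namespace Literature.AlgebraicGeometry.RelativeSpec.ActionOver

variable {X Q : Scheme.{u}} {p : X ⟶ Q} {G : Type u} [Group G] (ρ : ActionOver p G)

/-! ## §1 The generator `e(η_p 1)` of a trivialised pull-back: sections are its multiples, coefficients are unique -/

section Generator

variable (M : Q.Modules)
  (e : (Scheme.Modules.pullback p).obj (SheafOfModules.unit Q.ringCatSheaf) ≅ (Scheme.Modules.pullback p).obj M)

omit [Group G] in
/-- `η_p(1)|_{p⁻¹V}`-multiples: every section of `p^* 𝒪_Q` over `p⁻¹ V` is `b · η_p(1_V)` for a function `b`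
(★ `exists_eq_smul_of_iso_unit` along `p^* 𝒪_Q ≅ 𝒪_X`). [cite: MumfordAV1970, §12 Thm. 1 (p. 112)] -/
theorem exists_eq_smul_unitSection_one (V : Q.Opens)
    (t : Γ((Scheme.Modules.pullback p).obj (SheafOfModules.unit Q.ringCatSheaf), p ⁻¹ᵁ V)) :
    ∃ b : Γ(X, p ⁻¹ᵁ V), t = b • unitSection p (SheafOfModules.unit Q.ringCatSheaf) V (1 : Γ(Q, V)) := by
  haveI : IsIso (C := X.Modules) (SheafOfModules.pullbackObjUnitToUnit p.toRingCatSheafHom) := by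
    haveI := Literature.AlgebraicGeometry.KTheory.final_opensMap p
    exact SheafOfModules.instIsIsoPullbackObjUnitToUnitOfFinal _
  let γ : (Scheme.Modules.pullback p).obj (SheafOfModules.unit Q.ringCatSheaf) ≅ SheafOfModules.unit X.ringCatSheaf :=
    asIso (C := X.Modules) (SheafOfModules.pullbackObjUnitToUnit p.toRingCatSheafHom)
  refine exists_eq_smul_of_iso_unit _ γ _ ?_ t
  have hγ : (show Γ(X, p ⁻¹ᵁ V) from γ.hom.app (p ⁻¹ᵁ V)
      (unitSection p (SheafOfModules.unit Q.ringCatSheaf) V (1 : Γ(Q, V)))) = 1 := by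
    change Scheme.Modules.Hom.app (SheafOfModules.pullbackObjUnitToUnit p.toRingCatSheafHom) (p ⁻¹ᵁ V)
      (unitSection p (SheafOfModules.unit Q.ringCatSheaf) V (1 : Γ(Q, V))) = (1 : Γ(X, p ⁻¹ᵁ V))
    rw [pullbackObjUnitToUnit_app_unitSection]
    exact map_one (p.app V).hom
  rw [hγ]
  exact isUnit_one

omit [Group G] in
/-- **Coefficients on the generator are unique**: `x · e(η_p 1_V) = x′ · e(η_p 1_V) ⟹ x = x′` (apply `e⁻¹` and
`p^* 𝒪_Q → 𝒪_X`, which sends `η_p 1_V` to `1`). [cite: MumfordAV1970, §12 Thm. 1 (p. 112)] -/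
theorem eq_of_smul_generator_eq (V : Q.Opens) (x x' : Γ(X, p ⁻¹ᵁ V))
    (h : x • e.hom.app (p ⁻¹ᵁ V) (unitSection p (SheafOfModules.unit Q.ringCatSheaf) V (1 : Γ(Q, V))) =
      x' • e.hom.app (p ⁻¹ᵁ V) (unitSection p (SheafOfModules.unit Q.ringCatSheaf) V (1 : Γ(Q, V)))) : x = x' := by
  have h1 : ∀ z : Γ(X, p ⁻¹ᵁ V), e.inv.app (p ⁻¹ᵁ V)
      (z • e.hom.app (p ⁻¹ᵁ V) (unitSection p (SheafOfModules.unit Q.ringCatSheaf) V (1 : Γ(Q, V)))) =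
        z • unitSection p (SheafOfModules.unit Q.ringCatSheaf) V (1 : Γ(Q, V)) := fun z => by
    rw [Scheme.Modules.Hom.app_smul, ← CategoryTheory.comp_apply, ← Scheme.Modules.Hom.comp_app, e.hom_inv_id,
      Scheme.Modules.Hom.id_app, CategoryTheory.id_apply]
  have h2 : ∀ z : Γ(X, p ⁻¹ᵁ V), Scheme.Modules.Hom.app (SheafOfModules.pullbackObjUnitToUnit p.toRingCatSheafHom) (p ⁻¹ᵁ V)
      (z • unitSection p (SheafOfModules.unit Q.ringCatSheaf) V (1 : Γ(Q, V))) = z := fun z => by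
    rw [Scheme.Modules.Hom.app_smul, pullbackObjUnitToUnit_app_unitSection, map_one]
    exact mul_one z
  have h3 := congrArg (fun s => Scheme.Modules.Hom.app (SheafOfModules.pullbackObjUnitToUnit p.toRingCatSheafHom)
    (p ⁻¹ᵁ V) (e.inv.app (p ⁻¹ᵁ V) s)) h
  simp only [h1, h2] at h3
  exact h3

/-- **The eigen-relation restricts**: if `g · s = a · s` for the global generator `s = e(η_p 1)`, then
`g · s_V = a|_V · s_V` for `s_V = e(η_p 1_V)` over every `p⁻¹ V` (★ `actSections_map`, `unitSection_unit_eq`).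
[cite: MumfordAV1970, §12 Thm. 1 (p. 112)] -/
theorem actSections_generator_eq_smul_of_top (g : G) (a : Γ(X, p ⁻¹ᵁ ⊤))
    (h : ρ.actSections _ (EquivariantStructure.ofPullback ρ M).iso g ⊤
        (e.hom.app (p ⁻¹ᵁ ⊤) (unitSection p (SheafOfModules.unit Q.ringCatSheaf) ⊤ (1 : Γ(Q, ⊤)))) =
      a • e.hom.app (p ⁻¹ᵁ ⊤) (unitSection p (SheafOfModules.unit Q.ringCatSheaf) ⊤ (1 : Γ(Q, ⊤))))
    (V : Q.Opens) :
    ρ.actSections _ (EquivariantStructure.ofPullback ρ M).iso g V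
        (e.hom.app (p ⁻¹ᵁ V) (unitSection p (SheafOfModules.unit Q.ringCatSheaf) V (1 : Γ(Q, V)))) =
      X.presheaf.map ((Opens.map p.base).map (homOfLE (le_top : V ≤ ⊤))).op a •
        e.hom.app (p ⁻¹ᵁ V) (unitSection p (SheafOfModules.unit Q.ringCatSheaf) V (1 : Γ(Q, V))) := by
  -- `η_p(1_V) = η_p(1)|_{p⁻¹V}`
  have hres : unitSection p (SheafOfModules.unit Q.ringCatSheaf) V (1 : Γ(Q, V)) =
      ((Scheme.Modules.pullback p).obj (SheafOfModules.unit Q.ringCatSheaf)).presheaf.map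
        ((Opens.map p.base).map (homOfLE (le_top : V ≤ ⊤))).op
        (unitSection p (SheafOfModules.unit Q.ringCatSheaf) ⊤ (1 : Γ(Q, ⊤))) := by
    rw [unitSection_unit_eq (p := p) V (1 : Γ(Q, V)), map_one, one_smul]
  have h1 : e.hom.app (p ⁻¹ᵁ V)
      (((Scheme.Modules.pullback p).obj (SheafOfModules.unit Q.ringCatSheaf)).presheaf.map
        ((Opens.map p.base).map (homOfLE (le_top : V ≤ ⊤))).op
        (unitSection p (SheafOfModules.unit Q.ringCatSheaf) ⊤ (1 : Γ(Q, ⊤)))) =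
      ((Scheme.Modules.pullback p).obj M).presheaf.map ((Opens.map p.base).map (homOfLE (le_top : V ≤ ⊤))).op
        (e.hom.app (p ⁻¹ᵁ ⊤) (unitSection p (SheafOfModules.unit Q.ringCatSheaf) ⊤ (1 : Γ(Q, ⊤)))) :=
    app_presheaf_map _ _ _
  rw [hres, h1, ρ.actSections_map, h, Scheme.Modules.map_smul]

end Generator

/-! ## §2 Same character ⇒ isomorphic -/

section SameCharacter

variable [Fintype G]

/-- **Two quasi-coherent modules on a free finite quotient whose pull-backs are trivial WITH THE SAME CHARACTER are
isomorphic.**  For an affine flat geometric quotient `p : X ⟶ Q` by a free action of the finite group `G`, modules `M₁, M₂` on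
`Q` with trivialisations `eᵢ : p^* 𝒪_Q ≅ p^* Mᵢ` whose generators `sᵢ = eᵢ(η_p 1)` are eigen-sections with the SAME
eigenvalues, `g · sᵢ = a_g · sᵢ` (canonical linearisations ★ `EquivariantStructure.ofPullback`), are isomorphic: the composite
`p^* M₂ ≅ p^* 𝒪_Q ≅ p^* M₁` maps pulled-back sections of `M₂` to INVARIANT sections of `p^* M₁` (a pulled-back section is
`b · s₂` with `σ_g^♯(b) a_g = b`, and then `b · s₁` is invariant too), so `M₂` compares isomorphically with the invariants
`(p_* p^* M₁)^G ≅ M₁` (★ T1 `isIso_descentHom`, ★ `exists_hom_moduleInvariants_fac_of_actSections`, ★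
`isIso_of_isIso_pullback_map`).  [MumfordAV1970] §12 Thm. 1 / §15: the kernel of `Pic(X/G) → Pic(X)` injects into the
characters `Hom(G, Γ(X, 𝒪_X)ˣ)`. [cite: MumfordAV1970, §12 Thm. 1 (p. 112) and §15 Thm. 1 (p. 143)]
[cite: Greither1992CyclicGalois, Ch. 0 Thm. 7.1, Prop. 7.2 (pp. 28–29)] -/
theorem nonempty_iso_of_actSections_eq_smul [IsAffineHom p] [Flat p] (hq : ρ.IsGeometricQuotient p)
    (hfree : ∀ (V : Q.Opens), IsAffineOpen V → ∀ g : G, g ≠ 1 →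
      Ideal.span (Set.range fun b : Γ(X, p ⁻¹ᵁ V) ↦ ρ.act g V b - b) = ⊤)
    (M₁ M₂ : Q.Modules) [((Scheme.Modules.pullback p).obj M₁).IsQuasicoherent]
    [((Scheme.Modules.pullback p).obj M₂).IsQuasicoherent]
    (e₁ : (Scheme.Modules.pullback p).obj (SheafOfModules.unit Q.ringCatSheaf) ≅ (Scheme.Modules.pullback p).obj M₁)
    (e₂ : (Scheme.Modules.pullback p).obj (SheafOfModules.unit Q.ringCatSheaf) ≅ (Scheme.Modules.pullback p).obj M₂)
    (a : G → Γ(X, p ⁻¹ᵁ ⊤))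
    (h₁ : ∀ g : G, ρ.actSections _ (EquivariantStructure.ofPullback ρ M₁).iso g ⊤
        (e₁.hom.app (p ⁻¹ᵁ ⊤) (unitSection p (SheafOfModules.unit Q.ringCatSheaf) ⊤ (1 : Γ(Q, ⊤)))) =
      a g • e₁.hom.app (p ⁻¹ᵁ ⊤) (unitSection p (SheafOfModules.unit Q.ringCatSheaf) ⊤ (1 : Γ(Q, ⊤))))
    (h₂ : ∀ g : G, ρ.actSections _ (EquivariantStructure.ofPullback ρ M₂).iso g ⊤
        (e₂.hom.app (p ⁻¹ᵁ ⊤) (unitSection p (SheafOfModules.unit Q.ringCatSheaf) ⊤ (1 : Γ(Q, ⊤)))) =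
      a g • e₂.hom.app (p ⁻¹ᵁ ⊤) (unitSection p (SheafOfModules.unit Q.ringCatSheaf) ⊤ (1 : Γ(Q, ⊤)))) :
    Nonempty (M₂ ≅ M₁) := by
  have hE : IsAffineLocalizing ((Scheme.Modules.pullback p).obj M₁) := IsAffineLocalizing.of_isQuasicoherent _
  haveI : Surjective p := ⟨hq.surjective⟩
  haveI hdesc : IsIso (ρ.descentHom _ (EquivariantStructure.ofPullback ρ M₁).iso) :=
    ρ.isIso_descentHom _ (EquivariantStructure.ofPullback ρ M₁).iso hq hfree hE
      (EquivariantStructure.ofPullback ρ M₁).iso_one_hom (EquivariantStructure.ofPullback ρ M₁).iso_mul_hom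
  -- `M₁` compares with the invariants through the identity of `p^* M₁`
  obtain ⟨j₁, hj₁⟩ := ρ.exists_hom_moduleInvariants_fac _ (EquivariantStructure.ofPullback ρ M₁).iso M₁
    (𝟙 ((Scheme.Modules.pullback p).obj M₁)) fun g => by
      rw [CategoryTheory.Functor.map_id, Category.id_comp, Category.comp_id]; rfl
  -- the comparison `e′ : p^* M₂ ⟶ p^* M₁`; abbreviations for the generators over `p⁻¹ V`
  set e' : (Scheme.Modules.pullback p).obj M₂ ⟶ (Scheme.Modules.pullback p).obj M₁ := e₂.inv ≫ e₁.hom with he'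
  -- `e′` maps pulled-back sections of `M₂` to invariant sections
  have hinv : ∀ (g : G) (V : Q.Opens) (y : Γ(M₂, V)),
      ρ.actSections _ (EquivariantStructure.ofPullback ρ M₁).iso g V (e'.app (p ⁻¹ᵁ V) (unitSection p _ V y)) =
        e'.app (p ⁻¹ᵁ V) (unitSection p _ V y) := by
    intro g V y
    -- the section `t = η_p(y)` of `p^* M₂` is `b · s₂` for a function `b` on `p⁻¹ V`
    obtain ⟨b, hb⟩ := exists_eq_smul_unitSection_one (p := p) V (e₂.inv.app (p ⁻¹ᵁ V) (unitSection p M₂ V y))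
    have ht : unitSection p M₂ V y = b • e₂.hom.app (p ⁻¹ᵁ V)
        (unitSection p (SheafOfModules.unit Q.ringCatSheaf) V (1 : Γ(Q, V))) := by
      rw [← Scheme.Modules.Hom.app_smul, ← hb, ← CategoryTheory.comp_apply, ← Scheme.Modules.Hom.comp_app,
        e₂.inv_hom_id, Scheme.Modules.Hom.id_app, CategoryTheory.id_apply]
    -- the eigen-relations over `p⁻¹ V`
    have hs₂ := ρ.actSections_generator_eq_smul_of_top M₂ e₂ g (a g) (h₂ g) V
    have hs₁ := ρ.actSections_generator_eq_smul_of_top M₁ e₁ g (a g) (h₁ g) V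
    -- invariance of `η_p(y)`: `σ_g^♯(b) · a_g|_V = b`
    have hfix := ρ.actSections_unitSection_ofPullback M₂ g V y
    rw [ht, ρ.actSections_smul, hs₂, smul_smul] at hfix
    have hcoef := eq_of_smul_generator_eq (p := p) M₂ e₂ V _ _ hfix
    -- `e′(η_p y) = b · s₁`
    have he't : e'.app (p ⁻¹ᵁ V) (unitSection p M₂ V y) =
        b • e₁.hom.app (p ⁻¹ᵁ V) (unitSection p (SheafOfModules.unit Q.ringCatSheaf) V (1 : Γ(Q, V))) := by
      rw [he', Scheme.Modules.Hom.comp_app, CategoryTheory.comp_apply, hb, Scheme.Modules.Hom.app_smul]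
    rw [he't, ρ.actSections_smul, hs₁, smul_smul, hcoef]
  obtain ⟨j₂, hj₂⟩ :=
    ρ.exists_hom_moduleInvariants_fac_of_actSections _ (EquivariantStructure.ofPullback ρ M₁).iso _ e' hinv
  haveI : IsIso e' := by rw [he']; infer_instance
  haveI : IsIso ((Scheme.Modules.pullback p).map j₁) := IsIso.of_isIso_fac_right hj₁
  haveI : IsIso ((Scheme.Modules.pullback p).map j₂) := IsIso.of_isIso_fac_right hj₂
  haveI : IsIso j₁ := isIso_of_isIso_pullback_map p j₁
  haveI : IsIso j₂ := isIso_of_isIso_pullback_map p j₂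
  exact ⟨asIso j₂ ≪≫ (asIso j₁).symm⟩

end SameCharacter

end Literature.AlgebraicGeometry.RelativeSpec.ActionOver
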